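import Literature.AnabelianGeometry.SemiGraphs.ProSigmaPuncturedSurfaceElastic
import Literature.AnabelianGeometry.SemiGraphs.ProSigmaCompletionTFG
import Literature.AnabelianGeometry.SemiGraphs.ProSigmaCompletionModels
import Literature.AnabelianGeometry.SemiGraphs.ProSigmaCompletionTransport
import Literature.AnabelianGeometry.AbsoluteAnabelian.MLFGaloisElasticProofs
import HarnessLib

/-!
# [AbsTopI] Prop 2.2, Prop 2.3 (i) and Thm 2.6 (iv) for MLF-based extensions whose `Δ` is a pro-`Σ`
# completion of a hyperbolic punctured surface group — and a group-theoretic model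

S. Mochizuki, *Topics in Absolute Anabelian Geometry I: Generalities* (2012) [AbsTopI] (lit key
`paper:url-11ac98ba15fc`), Def 2.1 / Prop 2.2 p. 18 ("`Δ` is topologically finitely generated"), Prop 2.3 (i)
p. 19 ("`Δ` is slim and elastic"), Thm 2.6 (iv) p. 22 (for an MLF base: every almost pro-omissive
topologically finitely generated closed normal subgroup of `Π` lies in `Δ`; for `Σ ≠ Primes`, `Δ ⊆ Π` is
"characterized group-theoretically").  For an AFFINE hyperbolic curve of type `(g, r)`, `r ≥ 1`, over an MLF
`k`, with `Δ` the maximal pro-`Σ` quotient of its geometric fundamental group: `Δ` is the pro-`Σ`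
completion of the punctured surface group `Γ_{g,r}` (free of rank `2g + r − 1 ≥ 2`).

THIS PROOF-ONLY FILE (no definitions, no named facts) states the abc-iut cell's kernel theorems at that
MODEL CLASS — extensions `E : FundamentalExtension` with MLF base data `B : E.MLFBase` and a pro-`Σ`
completion structure `ι : Γ_{g,r} → Δ_E` on the geometric subgroup — and shows the class is inhabited:

* `IsProSet.of_isProSigmaCompletion` — a pro-`Σ` completion is pro-`Σ` in the sense of the L4 predicate
  `IsProSet` ([AbsTopI] Def 1.1 (iii) vocabulary; the junction with the L3 interface
  `SemiGraphOfAnabelioids.IsProSigmaCompletion`);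
* `FundamentalExtension.geom_props_of_isProSigmaCompletion_puncturedSurfaceGroup` — for such `E`:
  **`E.GeomTFG ∧ E.GeomSlimElastic ∧ IsProSet E.geom Σ`** (Prop 2.2 = tree `geomTFG_…`; Prop 2.3 (i) =
  abc-iut-w5-d206's `slim_and_elastic_of_isProSigmaCompletion_puncturedSurfaceGroup`, p424779);
* `FundamentalExtension.MLFBase.thm26iv_of_isProSigmaCompletion_puncturedSurfaceGroup` — **Thm 2.6 (iv)
  `E.Thm26iv Σ`** for such `E` (`Σ ⊆ Primes`), by `MLFBase.thm26iv` (elasticity of `G_k` = the cell's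
  theorem `isElastic_absoluteGaloisGroup`) — ALL its hypotheses now discharged at the model class;
* `FundamentalExtension.MLFBase.preservesGeom_of_isProSigmaCompletion_puncturedSurfaceGroup` — for
  `Σ ≠ Primes`, every `φ : Π_E ≃ₜ* Π_F` between two such extensions carries `Δ_E` onto `Δ_F`;
* `FundamentalExtension.exists_mlfBase_proSigma_model` — NON-VACUITY of the class: the PRODUCT
  extension `Π := Δ × G_{ℚ_p} ↠ G_{ℚ_p}` with `Δ` a pro-`Σ` completion of `Γ_{g,r}`
  (`exists_isProSigmaCompletion`) — HONEST LABEL: a group-theoretic model (the outer Galois action is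
  trivial, so this is NOT the arithmetic fundamental group of a curve); it certifies joint satisfiability
  of the hypotheses of the Thm 2.6 (iv) / (H1) chain, nothing more;
* `FundamentalExtension.exists_mlfBase_geomSlimElastic_thm26iv` — hence an MLF-based `E` with
  `E.GeomTFG ∧ E.GeomSlimElastic ∧ IsProSet E.geom Σ ∧ E.Thm26iv Σ` EXISTS (type `(0,3)`, any prime `p`,
  any `Σ ⊆ Primes` containing a prime) — the F-0239 / F-0240 predicates and the Thm 2.6 (iv) conclusion
  WITNESSED together at a nontrivial `Δ`.

Classical; nothing here bears on [IUTchIII] Cor. 3.12; no side is taken.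
-/

noncomputable section

open Topology

namespace Literature.AnabelianGeometry.AbsoluteAnabelian

open Literature.AnabelianGeometry.SemiGraphs.SemiGraphOfAnabelioids
open Literature.AnabelianGeometry.Anabelioids Literature.AlgebraicGeometry.Frobenioids
open Literature.GroupTheory.CombinatorialGroupTheory Field

universe u v

/-! ### `IsProSigmaCompletion` ⇒ `IsProSet` -/

/-- **A pro-`Σ` completion is pro-`Σ`** in the sense of [AbsTopI] Def 1.1 (iii) (`IsProSet`): the prime
divisors of the index of every open normal subgroup lie in `Σ` (the `index_open` clause of the L3
interface). [cite: MochizukiAbsTopI2012, Def 1.1 (iii) p.10] -/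
theorem IsProSet.of_isProSigmaCompletion {Sigma : Set ℕ} {Γ : Type u} [Group Γ] {P : Type v}
    [Group P] [TopologicalSpace P] {ι : Γ →* P} (hι : IsProSigmaCompletion Sigma ι) :
    IsProSet P Sigma :=
  ⟨fun U hUn hUo q hq hdvd => (hι.index_open U hUn hUo).2 q hq hdvd⟩

namespace FundamentalExtension

variable {E F : FundamentalExtension.{0}} {Sigma : Set ℕ} {g r : ℕ}

/-- **[AbsTopI] Prop 2.2 + Prop 2.3 (i) + "`Δ` pro-`Σ`" at the model class**: if `Δ_E` carries a pro-`Σ`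
completion structure `ι : Γ_{g,r} → Δ_E` of a hyperbolic punctured surface group (`r ≥ 1`) and `Σ` contains
a prime, then `Δ_E` is topologically finitely generated, slim and elastic, and pro-`Σ`.
[cite: MochizukiAbsTopI2012, Prop 2.3 (i) p.19] -/
theorem geom_props_of_isProSigmaCompletion_puncturedSurfaceGroup (hr : 1 ≤ r)
    (h : PuncturedSurfaceGroup.IsHyperbolicType g r) {ι : PuncturedSurfaceGroup g r →* E.geom}
    (hι : IsProSigmaCompletion Sigma ι) (hS : ∃ ℓ ∈ Sigma, ℓ.Prime) :
    E.GeomTFG ∧ E.GeomSlimElastic ∧ IsProSet E.geom Sigma := by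
  haveI : CompactSpace E.geom := isCompact_iff_compactSpace.mp E.isClosed_geom.isCompact
  exact ⟨geomTFG_of_isProSigmaCompletion_puncturedSurfaceGroup E ι hι,
    slim_and_elastic_of_isProSigmaCompletion_puncturedSurfaceGroup hr h hι hS,
    IsProSet.of_isProSigmaCompletion hι⟩

/-- **[AbsTopI] Thm 2.6 (iv) at the model class, all hypotheses discharged**: for `E` with MLF base data
and `Δ_E` a pro-`Σ` completion of a hyperbolic punctured surface group (`Σ ⊆ Primes`), the typed
`E.Thm26iv Σ` HOLDS (`GeomTFG` by Prop 2.2 at the model, pro-`Σ` by the completion structure, elasticity of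
`G ≅ G_k` by `isElastic_absoluteGaloisGroup`). [cite: MochizukiAbsTopI2012, Thm 2.6 (iv) p.22] -/
theorem MLFBase.thm26iv_of_isProSigmaCompletion_puncturedSurfaceGroup (B : E.MLFBase)
    {ι : PuncturedSurfaceGroup g r →* E.geom} (hι : IsProSigmaCompletion Sigma ι)
    (hS : Sigma ⊆ {q | q.Prime}) : E.Thm26iv Sigma :=
  B.thm26iv (geomTFG_of_isProSigmaCompletion_puncturedSurfaceGroup E ι hι) hS
    (IsProSet.of_isProSigmaCompletion hι)

/-- **"`Δ ⊆ Π` may be characterized group-theoretically"** ([AbsTopI] Thm 2.6 (iv), `Σ ≠ Primes`) at the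
model class: for two MLF-based extensions whose geometric subgroups are pro-`Σ` / pro-`T` completions of
punctured surface groups with `Σ, T ⊊ Primes`, EVERY isomorphism of topological groups `Π_E ⥲ Π_F`
carries `Δ_E` onto `Δ_F`. [cite: MochizukiAbsTopI2012, Thm 2.6 (iv) p.22] -/
theorem MLFBase.preservesGeom_of_isProSigmaCompletion_puncturedSurfaceGroup (BE : E.MLFBase)
    (BF : F.MLFBase) {ι : PuncturedSurfaceGroup g r →* E.geom} (hι : IsProSigmaCompletion Sigma ι)
    {T : Set ℕ} {g' r' : ℕ} {κ : PuncturedSurfaceGroup g' r' →* F.geom} (hκ : IsProSigmaCompletion T κ)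
    (hS : Sigma ⊆ {q | q.Prime}) (hS' : Sigma ≠ {q | q.Prime}) (hT : T ⊆ {q | q.Prime})
    (hT' : T ≠ {q | q.Prime}) (φ : E.arith ≃ₜ* F.arith) : PreservesGeom φ :=
  MLFBase.preservesGeom BE BF (geomTFG_of_isProSigmaCompletion_puncturedSurfaceGroup E ι hι)
    (geomTFG_of_isProSigmaCompletion_puncturedSurfaceGroup F κ hκ) hS hS'
    (IsProSet.of_isProSigmaCompletion hι) hT hT' (IsProSet.of_isProSigmaCompletion hκ) φ

/-! ### Non-vacuity of the model class (group-theoretic product model) -/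

/-- **The model class is inhabited with nontrivial `Δ`** (group-theoretic PRODUCT model — honest label: not
the `π₁` of a curve, the outer Galois action being trivial): for every prime `p`, hyperbolic `(g, r)` with
`r ≥ 1` and every `Σ`, there is an extension `E` with MLF base data (`G = G_{ℚ_p}`) whose `Δ_E` is a pro-`Σ`
completion of `Γ_{g,r}`: `Π := Δ × G_{ℚ_p}`, `aug :=` the second projection.
[cite: MochizukiAbsTopI2012, Def 2.1 p.18] -/
theorem exists_mlfBase_proSigma_model (p : ℕ) [Fact p.Prime] (g r : ℕ) (Sigma : Set ℕ) :
    ∃ (E : FundamentalExtension.{0}) (_ : E.MLFBase) (ι : PuncturedSurfaceGroup g r →* E.geom),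
      IsProSigmaCompletion Sigma ι := by
  classical
  obtain ⟨P, ι₀, hι₀⟩ :=
    IsProSigmaCompletion.exists_isProSigmaCompletion (PuncturedSurfaceGroup g r) Sigma
  let E : FundamentalExtension.{0} :=
    { arith := ProfiniteGrp.of (P × absoluteGaloisGroup ℚ_[p])
      gal := ProfiniteGrp.of (absoluteGaloisGroup ℚ_[p])
      aug := ⟨MonoidHom.snd P (absoluteGaloisGroup ℚ_[p]), continuous_snd⟩
      aug_surjective := fun y => ⟨(1, y), rfl⟩ }
  let B : E.MLFBase := { p := p, K := ℚ_[p], galIso := ContinuousMulEquiv.refl _ }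
  -- `Δ_E = P × 1 ≅ P`
  have hmem : ∀ x : P, ((x, (1 : absoluteGaloisGroup ℚ_[p])) : E.arith) ∈ E.geom := fun x => by
    rw [mem_geom]; rfl
  have hsnd : ∀ z : E.geom, (z : E.arith).2 = 1 := fun z => (mem_geom E).mp z.2
  let j : P →* E.geom :=
    { toFun := fun x => ⟨(x, 1), hmem x⟩
      map_one' := rfl
      map_mul' := fun a b => Subtype.ext (Prod.ext rfl (mul_one _).symm) }
  -- the first projection `Δ_E ≅ P` (inverse `j`), both continuous
  let e : E.geom ≃* P :=
    { toFun := fun z => (z : E.arith).1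
      invFun := j
      left_inv := fun z => Subtype.ext (Prod.ext rfl (hsnd z).symm)
      right_inv := fun _ => rfl
      map_mul' := fun _ _ => rfl }
  have he : Continuous e := continuous_fst.comp continuous_subtype_val
  have hes : Continuous e.symm := (continuous_id.prodMk continuous_const).subtype_mk _
  refine ⟨E, B, j.comp ι₀, ?_⟩
  exact IsProSigmaCompletion.of_target_mulEquiv hι₀ e he hes fun _ => rfl

/-- **Consequently the hypotheses of the Thm 2.6 (iv) / (H1) chain are jointly satisfiable with `Δ ≠ 1`**:
an MLF-based extension with `Δ` topologically finitely generated, slim, elastic (so nontrivial) and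
pro-`Σ`, satisfying `Thm26iv Σ`, EXISTS for every prime `p` and every `Σ ⊆ Primes` containing a prime.
[cite: MochizukiAbsTopI2012, Thm 2.6 (iv) p.22] -/
theorem exists_mlfBase_geomSlimElastic_thm26iv (p : ℕ) [Fact p.Prime] {Sigma : Set ℕ}
    (hS : Sigma ⊆ {q | q.Prime}) (hS' : ∃ ℓ ∈ Sigma, ℓ.Prime) :
    ∃ (E : FundamentalExtension.{0}) (_ : E.MLFBase),
      E.GeomTFG ∧ E.GeomSlimElastic ∧ IsProSet E.geom Sigma ∧ E.Thm26iv Sigma := by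
  -- type `(0, 3)`: the thrice-punctured line, `Γ_{0,3}` free of rank `2`
  obtain ⟨E, B, ι, hι⟩ := exists_mlfBase_proSigma_model p 0 3 Sigma
  have h3 : PuncturedSurfaceGroup.IsHyperbolicType 0 3 := by
    unfold PuncturedSurfaceGroup.IsHyperbolicType; norm_num
  obtain ⟨h1, h2, h4⟩ := geom_props_of_isProSigmaCompletion_puncturedSurfaceGroup (by norm_num) h3 hι hS'
  exact ⟨E, B, h1, h2, h4, B.thm26iv_of_isProSigmaCompletion_puncturedSurfaceGroup hι hS⟩

end FundamentalExtension

end Literature.AnabelianGeometry.AbsoluteAnabelian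

end
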